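import Mathlib.Data.Finset.Powerset
import Mathlib.Data.Fintype.Powerset
import Mathlib.Algebra.BigOperators.Group.Finset.Basic
import Literature.Computability.QuantumComplexity.GaussianRank

/-!
# Crux `SpinorFlattening.NegApproxGaussRankSuperpoly` (stmt-QuantumAdvantage-1245) — stub `stub_filterCard`

Line `spectral-mass-flattening`, stub `stub_filterCard` (COUNTING THE NORMAL-ORDERING INDEX SET): the
index set of the sorted complement words produced by the CAR normal-ordering step — the subsets
`I ⊆ Fin n` with `|I| ≤ K` and `|I| ≡ K (mod 2)` — has exactly
  `D_K(n) = flatteningDeficiency K n = Σ_{j ≤ K, j ≡ K (2)} C(n, j)`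
elements (also for `K > n`: both sides ignore the levels `j > n`, where `C(n, j) = 0` and no subset
of `Fin n` has `j` elements).

Proof: the index set is the disjoint union, over the levels `j ∈ {0, …, K}` of the parity of `K`, of
the `j`-element subsets of `Fin n` (`Finset.powersetCard j univ`, of size `C(n, j)`); the levels are
pairwise disjoint because their members have different cardinalities.
-/

namespace Summit.QuantumAdvantage.QuantumAdvantage.Theorems.SpinorFlattening

open Matrix Finset
open Literature.Computability.QuantumComplexity Literature.Computability.Cryptography

/-- Membership in the level decomposition: a subset `I ⊆ Fin n` lies in the union of the levels
`powersetCard j univ`, `j ≤ K`, `j ≡ K (mod 2)`, iff `|I| ≤ K` and `|I| ≡ K (mod 2)`. -/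
theorem filterCard_mem_biUnion_iff (n K : ℕ) (I : Finset (Fin n)) :
    I ∈ ((Finset.range (K + 1)).filter (fun j => j % 2 = K % 2)).biUnion
        (fun j => Finset.powersetCard j (Finset.univ : Finset (Fin n))) ↔
      I.card ≤ K ∧ I.card % 2 = K % 2 := by
  simp only [Finset.mem_biUnion, Finset.mem_filter, Finset.mem_range,
    Finset.mem_powersetCard_univ]
  constructor
  · rintro ⟨j, ⟨hj, hj2⟩, rfl⟩
    exact ⟨Nat.le_of_lt_succ hj, hj2⟩
  · rintro ⟨h1, h2⟩
    exact ⟨I.card, ⟨Nat.lt_succ_of_le h1, h2⟩, rfl⟩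

/-- The levels `powersetCard j univ` of the decomposition are pairwise disjoint (their members have
different cardinalities). -/
theorem filterCard_pairwiseDisjoint (n K : ℕ) :
    (((Finset.range (K + 1)).filter (fun j => j % 2 = K % 2) : Finset ℕ) : Set ℕ).PairwiseDisjoint
      (fun j => Finset.powersetCard j (Finset.univ : Finset (Fin n))) :=
  fun _ _ _ _ hij => Finset.pairwise_disjoint_powersetCard _ hij

/-- **stub_filterCard** — the normal-ordering index set is counted by the deficiency: the subsets of
`Fin n` of size `≤ K` and of the parity of `K` number `Σ_{j ≤ K, j ≡ K (2)} C(n,j) = flatteningDeficiency K n`. -/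
theorem stub_filterCard :
    ∀ n K : ℕ, Fintype.card {I : Finset (Fin n) // I.card ≤ K ∧ I.card % 2 = K % 2} =
      flatteningDeficiency K n := by
  intro n K
  rw [Fintype.card_of_subtype _ (filterCard_mem_biUnion_iff n K),
    Finset.card_biUnion (filterCard_pairwiseDisjoint n K), flatteningDeficiency_eq]
  refine Finset.sum_congr rfl fun j _ => ?_
  rw [Finset.card_powersetCard, Finset.card_univ, Fintype.card_fin]

end Summit.QuantumAdvantage.QuantumAdvantage.Theorems.SpinorFlattening
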